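import Summits.PneNP.PneNP.Theses.ConvexRankGates
import Literature.Computability.Complexity.ExtMonotoneGates

/-!
# Sketch (ideator 5, round 2) for crux `Capture` (stmt-PneNP-2659): the SELF-DUALITY AUDIT and the
DUAL-TUTTE door

First-lemma signatures for the crux idea card `dual-tutte-self-duality-audit` (no proofs, no sorries;
every constant is an existing declaration). Notation: `g^d(v) = ¬ g(¬ v)` is the Boolean dual; monotone
`P/poly` is closed under `f ↦ f^d` at cost `O(n)`, hence `Capture` forces the extended basis to capture the
dual of every TAME (P/poly-evaluable) extended gate. The card audits the four gate classes:
LP/SDP (closed: L1), abelian PERM (closed, Karchmer–Wigderson 1993), GRANK over `ℚ` (OPEN: L3), nonabelian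
PERM (open), and names the first explicit instance of L3: the dual of Tutte's generic-rank gate, i.e.
`h_n(S) = [K_n − S has no perfect matching]` (THE DOOR, `noPMAfterDeletion`).
-/

noncomputable section

set_option linter.dupNamespace false

namespace Summit.PneNP.PneNP.Cruxes.Capture.Ideator5

open Literature.Computability.Complexity
open scoped BigOperators

/-- Boolean dual of a gate function, `g^d(v) = ¬ g(¬ v)` (same arity; monotone iff `g` is). -/
def dualGate (g : GateFn) : GateFn := ⟨g.1, fun v => !(g.2 fun i => !(v i))⟩

/-- LP sub-class of CONV (diagonal `Y`): `g v ↔ {y ≥ 0 : A y ≤ b + B v} ≠ ∅`, `B ≥ 0`, rows + cols `≤ s`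
(Oliveira–Pudlák max-right weak MLP gate, domain-of-definition form). -/
def IsLPGate (s : ℕ) (g : GateFn) : Prop :=
  ∃ p q : ℕ, p + q ≤ s ∧ ∃ (A : Matrix (Fin p) (Fin q) ℝ) (b : Fin p → ℝ) (B : Fin p → Fin g.1 → ℝ),
    (∀ i j, 0 ≤ B i j) ∧ ∀ v : Fin g.1 → Bool, g.2 v = true ↔
      ∃ y : Fin q → ℝ, (∀ j, 0 ≤ y j) ∧
        ∀ i, (A.mulVec y) i ≤ b i + ∑ j, B i j * (if v j then (1 : ℝ) else 0)

/-- **L1 (first lemma, provable).** LP gates are closed under Boolean duality with polynomial loss: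
Farkas' lemma (infeasibility of `{y ≥ 0 : Ay ≤ b + B(1-v)}` ⇔ a certificate `μ ≥ 0`, `μᵀA ≥ 0`,
`μᵀ(b + B(1-v)) < 0`), finitely many extreme rays of `{μ ≥ 0 : μᵀA ≥ 0}` give a uniform big-`M`, and the
bilinear term `μᵢ·vⱼ` is linearised by `νᵢⱼ ≤ μᵢ`, `νᵢⱼ ≤ M·vⱼ` (so the input enters with `B' ≥ 0`).
Equivalently: Hrubeš's monotone separation complexity satisfies `sep₊(f^d) = sep₊(f) ± O(n)` because
`M₊(f^d) = M₊(f)ᵀ`. -/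
def LPDualClosed : Prop :=
  ∃ c : ℕ, ∀ (s : ℕ) (g : GateFn), IsLPGate s g → IsLPGate ((s + g.1 + 2) ^ c) (dualGate g)

/-- Dual capture of a gate class `P` inside the extended basis: the dual of every `P`-gate of size `s` and
arity `k` has an `extGate`-circuit of size polynomial in `s + k`. -/
def DualCaptured (P : ℕ → GateFn → Prop) : Prop :=
  ∃ c : ℕ, ∀ (s : ℕ) (g : GateFn), P s g → ∃ C : Circuit (Fin g.1),
    C.IsOver (extGate ((s + g.1 + 2) ^ c)) ∧ C.size ≤ (s + g.1 + 2) ^ c ∧ C.Computes (dualGate g).2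

/-- TAME GRANK gates: generic-rank thresholds over `ℚ` with integer data of absolute value `≤ 2^s`
(these are `P/poly`-evaluable by Schwartz–Zippel + amplification, so `Capture` applies to their duals). -/
def IsTameGRankGate (s : ℕ) (g : GateFn) : Prop :=
  ∃ d θ : ℕ, d ≤ s ∧ ∃ (K₀ : Matrix (Fin d) (Fin d) ℚ) (K : Fin g.1 → Matrix (Fin d) (Fin d) ℚ),
    (∀ i j, ∃ z : ℤ, K₀ i j = z ∧ |z| ≤ 2 ^ s) ∧ (∀ l i j, ∃ z : ℤ, K l i j = z ∧ |z| ≤ 2 ^ s) ∧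
      ∀ v : Fin g.1 → Bool, g.2 v = true ↔ θ ≤ (symbolicMatrix K₀ K v).rank

/-- **L3 (the open rung of the audit).** Duals of tame GRANK gates — "every monomial of
`det(K₀ + ∑ Xᵢ Kᵢ)` meets the selected set", i.e. the BLOCKER of a determinantal clutter — are captured by
the extended basis. `Capture ⇒ L3` (necessary condition); `¬L3 ⇒ ¬Capture`. TRUE for coordinate pencils
(single linear matroid: cocircuits = OR of span programs) and for bipartite Edmonds pencils (König ⇒ one
LP gate); OPEN for rank-one pencils in general (linear matroid intersection) and for rank-two skew pencils
(Tutte: the door below). -/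
def GRankDualCaptured : Prop := DualCaptured IsTameGRankGate

/-- THE DOOR. The dual of the Tutte gate: `h_n(x) = [K_n minus the selected edges has no perfect
matching]` (monotone in the selection; in `P`; monotone circuit complexity = that of perfect matching). -/
def noPMAfterDeletion (n : ℕ) (x : (⊤ : SimpleGraph (Fin n)).edgeSet → Bool) : Bool :=
  @decide (¬ ∃ M : (⊤ : SimpleGraph (Fin n)).Subgraph, M.IsPerfectMatching ∧
    ∀ e : (⊤ : SimpleGraph (Fin n)).edgeSet, (e : Sym2 (Fin n)) ∈ M.edgeSet → x e = false)
    (Classical.dec _)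

/-- The door is shut iff `h_n` has polynomial extended-basis circuits. -/
def DualTutteCaptured : Prop :=
  ∃ c : ℕ, ∀ n : ℕ, 4 ≤ n → ∃ C : Circuit ((⊤ : SimpleGraph (Fin n)).edgeSet),
    C.IsOver (extGate (n ^ c)) ∧ C.size ≤ n ^ c ∧ C.Computes (noPMAfterDeletion n)

/-- `h_n` has polynomial B2-circuits (Edmonds' algorithm / `perfectMatching_polysize`-type fact). -/
def DualTuttePolyB2 : Prop :=
  ∃ k : ℕ, ∀ n : ℕ, 4 ≤ n → ∃ C : Circuit ((⊤ : SimpleGraph (Fin n)).edgeSet),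
    C.IsOver B2 ∧ C.size ≤ n ^ k ∧ C.Computes (noPMAfterDeletion n)

/-- **L0 (provable bookkeeping, same shape as the route's `closes`).** `Capture` shuts the door: apply
`Capture` to the B2-circuit of the monotone function `h_n` and absorb `(t + C(n,2) + 2)^a ≤ n^{c}`. -/
def CaptureShutsDoor : Prop :=
  Summit.PneNP.PneNP.Theses.ConvexRankGates.Capture → DualTuttePolyB2 → DualTutteCaptured

/-- **CONV_LP coordinate of the door = strict rank of the odd-cut incidence matrix** (Hrubeš 2020 Thm 20 for
`f = PM`, plus L1): if for every polynomial bound `n^c` and every `ε > 0` the matrix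
`(|M ∩ δ(U)| − ε)_{U odd, M perfect matching}` has NO non-negative factorisation with `≤ n^c` terms
(eventually in even `n`), then neither perfect matching nor its dual `h_n` is one polynomial LP gate.
Known: exponential for every FIXED `ε ∈ (0, 1]` (ε = 1: Rothvoss 2017 = `rothvoss_matching_slack_bound`;
0 < ε < 1: Braun–Pokutta 2015 Thm 3.1); open as `ε → 0` with `n` (Hrubeš's ε-sensitivity). -/
def OddCutStrictRankSuperpoly : Prop :=
  ∀ c : ℕ, ∀ᶠ n : ℕ in Filter.atTop, Even n → ∀ r : ℕ, r ≤ n ^ c → ∀ ε : ℝ, 0 < ε →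
    ∀ (a : Finset (Fin n) → Fin r → ℝ) (b : (⊤ : SimpleGraph (Fin n)).Subgraph → Fin r → ℝ),
      (∀ U i, 0 ≤ a U i) → (∀ M i, 0 ≤ b M i) →
        ¬ ∀ (U : Finset (Fin n)) (M : (⊤ : SimpleGraph (Fin n)).Subgraph),
            Odd U.card → M.IsPerfectMatching →
              ((M.edgeSet ∩ {e | ∃ x ∈ U, ∃ y ∉ U, e = s(x, y)}).ncard : ℝ) - ε = ∑ i, a U i * b M i

/-- Repair suggested to the tenure planner (not a change of the crux): the SELF-DUAL extended basis adjoins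
the syntactic duals of PERM and GRANK gates (monotone by syntax: removing generators only shrinks a
subgroup / a generic rank). `Capture` over `extGate` implies `Capture` over `sdExtGate`. -/
def sdExtGate (s : ℕ) : Set GateFn :=
  extGate s ∪ {g | ∃ g' : GateFn, (IsPermGate s g' ∨ IsGRankGate s g') ∧ g = dualGate g'}

/-- Sanity: the self-dual basis contains the basis. -/
theorem extGate_subset_sdExtGate (s : ℕ) : extGate s ⊆ sdExtGate s := fun _ h => Or.inl h

end Summit.PneNP.PneNP.Cruxes.Capture.Ideator5
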